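import Literature.AlgebraicGeometry.HodgeTheory.DivisorLefschetzGroup
import Literature.AlgebraicGeometry.HodgeTheory.WeilClassesFieldRationalSpan
import Mathlib.LinearAlgebra.Eigenspace.Minpoly
import HarnessLib

/-!
# «`G_div(X) ⊗ ℂ` splits as the direct product of `e₀` factors `G_div^{(τ)}`» along the eigenspaces of the totally
# real centre, and the central elements `U_{K_B}(ℂ) ∋ a`, `a a† = 1` — Moonen–Zarhin 1998 §1 + Lemma (1), on the
# carrier (PROVED, blockwise form)

Layer `Literature/AlgebraicGeometry/HodgeTheory`; THEOREMS ONLY (no definition, no named fact; D-0026 net debt 0).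
Sequel of `HodgeTheory/DivisorLefschetzGroup` (the print's `G_div(X)(ℂ) = divisorLefschetzGroup A h`,
`S_λ ⊗ ℂ = symmetricPullbackSpan A h`) and of `WeilClassesFieldRationalSpan` (an eigenbasis of `H¹(A(ℂ); ℂ)` for the
pull-back of an endomorphism with irreducible minimal polynomial).

## The print

B. J. J. Moonen, Yu. G. Zarhin, *Weil classes on abelian varieties*, J. reine angew. Math. **496** (1998) =
arXiv:alg-geom/9612017 [MoonenZarhin1998WeilClasses], §1 (held chunk p0002 L86–L100), VERBATIM: «Write `Σ_{E₀}` for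
the set of complex (in fact real) embeddings of `E₀`. We have `SP(V_Y, φ_Y) ⊗ ℂ = ∏_{τ ∈ Σ_{E₀}} SP(V^{(τ)}_{Y,ℂ}, φ^{(τ)}_Y)`
and `Δ ⊗ ℂ = ∏_{τ ∈ Σ_{E₀}} Δ^{(τ)}_ℂ`, where `Δ^{(τ)}_ℂ` is a semi-simple `ℂ`-subalgebra of `End(V^{(τ)}_{Y,ℂ})`. We thus
see that `G_div(X) ⊗ ℂ` splits as the direct product of `e₀` factors `G_div^{(τ)}`.» (Here `E₀` is the maximal
totally real subfield of the centre `E` of `D = End⁰(Y)`, `X = Y^m`.)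

## What is proved (carrier `V ⊗ ℂ = H¹(A(ℂ); ℂ)`; every complex abelian variety `A`, any class `h`)

Let `ζ ∈ End(A)` with `P(ζ) = 0` for an irreducible `P ∈ ℤ[T]`, and write `V^{(τ)} = ker(ζ^* - τ) ⊆ H¹(A(ℂ); ℂ)`
for `τ ∈ ℂ` (non-zero exactly at the complex roots of `P`, the embeddings of `ℚ(ζ)`). The print's `ζ` is CENTRAL
(`ζ^* ∈ C(A) ⊗ ℂ`, i.e. `ζ^*` commutes with every pull-back: hypothesis `hζC`) and `†`-SYMMETRIC
(`Q_h(ζ^* x, y) = Q_h(x, ζ^* y)`: hypothesis `hsym`) — a generator of `E₀ = Z(End⁰(X))^{† = id}` when `X = Y^m`, the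
`τ` with `V^{(τ)} ≠ 0` being `Σ_{E₀}`; §5 also treats a central `ζ` with `ζ† = q(ζ)` (hypothesis `hadj`, e.g. a
generator of a CM centre `E`). Each theorem carries exactly the hypotheses it uses.

* §1 `iSup_eigenspace_pullbackOne_eq_top` — `H¹(A(ℂ); ℂ) = ⊕_τ V^{(τ)}` (as a supremum; eigenbasis of `ζ^*`).
* §2 `pullbackOne_mem_symmetricPullbackSpan` (`ζ^* ∈ S_λ ⊗ ℂ`), **`apply_mem_eigenspace_of_mem_divisorLefschetzGroup`**
  (every `u ∈ G_div(X)(ℂ)` preserves each `V^{(τ)}`; `…_of_mem_adjoin` for any `ζ^* ∈ B ⊗ ℂ`),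
  **`polarizationPairingOne_eq_zero_of_mem_eigenspace_of_ne`** (`Q_h(V^{(τ)}, V^{(τ′)}) = 0` for `τ ≠ τ′`:
  «`SP(V, φ) ⊗ ℂ = ∏_τ SP(V^{(τ)}, φ^{(τ)})`»; general form `…_of_ne_eval` for a Rosati conjugate `ζ† = q(ζ)`:
  `V^{(τ′)}` pairs only with `V^{(q(τ′))}`), **`apply_mem_eigenspace_of_mem_symmetricPullbackSpan`** (`S_λ ⊗ ℂ`,
  indeed every `ℂ`-combination of pull-backs, preserves each `V^{(τ)}` of a CENTRAL `ζ`: «`Δ ⊗ ℂ = ∏_τ Δ^{(τ)}_ℂ`»),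
  `polarizationPairingOne_map_eq_of_forall_eigenspace(_of_adjoint)` (blockwise `Q_h`-invariance is global).
* §3 **`mem_divisorLefschetzGroup_iff_forall_eigenspace`** — «`G_div(X) ⊗ ℂ` splits as the direct product of the
  `G_div^{(τ)}`»: an automorphism `u` of `H¹(A(ℂ); ℂ)` lies in `G_div(X)(ℂ)` IFF it preserves every `V^{(τ)}` and, on each
  `V^{(τ)}` separately, commutes with `S_λ ⊗ ℂ` and preserves `Q_h` — membership is a conjunction of independent
  blockwise conditions (the factor `G_div^{(τ)}` being the group cut out on `V^{(τ)}` by `S_λ|_{V^{(τ)}}` and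
  `Q_h|_{V^{(τ)}}`; only the `†`-symmetry of `ζ` is used for the equivalence, centrality makes the blocks
  `S_λ`-stable); §1 `eq_of_forall_eigenspace_apply_eq` / `apply_apply_eq_of_forall_eigenspace` — a linear map is
  determined by its blocks / blockwise commutation is global.
* §4 the same splitting for Milne's `S(A)(h)(ℂ) = unitaryCentralizerGroup A h` (centralizer of ALL pull-backs):
  **`mem_unitaryCentralizerGroup_iff_forall_eigenspace`** (Milne 1999 §2: `S(A)_{/ℂ} = ∏_σ S_σ` along the centre).
* §5 Lemma (1) «`Z(G_div(X)) = U_{K_B}`, `U_{K_B}(R) = {a ∈ (K_B ⊗ R)^* | a a† = 1}`», THE ELEMENTS, for a central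
  `ζ` with Rosati conjugate `ζ† = q(ζ)` a polynomial in `ζ` (`q = T` on `E₀`; `q` = complex conjugation on a CM
  centre): **`exists_mem_divisorLefschetzGroup_coe_eq_aeval_of_adjoint`** — every `a = p(ζ^*)` with `a a† = 1`
  (`p(τ) p(q(τ)) = 1` at the eigenvalues) underlies an element of `G_div(X)(ℂ)` (`U_{ℚ(ζ)}(ℂ) ⊆ G_div(X)(ℂ)`: «a
  connected torus of rank e₀» in type IV with `d ≥ 2` or `m ≥ 2`, finite otherwise);
  **`exists_mem_divisorLefschetzGroup_coe_eq_aeval_iff`** — and ONLY those: for `Q_h` non-degenerate, `p(ζ^*)`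
  underlies an element of `G_div(X)(ℂ)` iff `a a† = 1` (`eval_mul_eval_eq_one_of_forall_polarizationPairingOne_aeval_eq`);
  **`exists_mem_divisorLefschetzGroup_coe_eq_aeval`** — the `2^{#Σ}` SIGN ELEMENTS (`†`-symmetric `ζ`, `p(τ) = ±1`
  chosen independently per block: `μ₂^{Σ_{E₀}} = U_{E₀}(ℂ) ⊆ G_div(X)(ℂ)`, independent blockwise elements of
  `∏_τ G_div^{(τ)}`); **`exists_mem_center_divisorLefschetzGroup_coe_eq_aeval`** — they are CENTRAL when
  `ζ^* ∈ B ⊗ ℂ` (with the tree's `mem_center_divisorLefschetzGroup_of_coe_mem_adjoin`), and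
  `apply_aeval_pullbackOne_eq_of_mem_divisorLefschetzGroup` (symmetric `ζ`); `aeval_pullbackOne_mul_aeval_comp_eq_one`
  / `aeval_pullbackOne_mul_self_eq_one` (`a a† = 1` / `p(ζ^*)² = 1` on the carrier);
  `exists_mem_unitaryCentralizerGroup_coe_eq_aeval_of_adjoint` — the same elements lie in the centre of Milne's
  `S(A)(h)(ℂ)`.
* §6 (rider) «in all other cases it is finite» for the `E₀`-part: for `†`-symmetric `ζ` and `Q_h` non-degenerate an
  element `u ∈ G_div(X)(ℂ)` of the form `p(ζ^*)` has `p(τ) = ±1` at every eigenvalue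
  (`eval_eq_one_or_eval_eq_neg_one_of_mem_divisorLefschetzGroup_coe_eq_aeval`), is an involution
  (`mul_self_eq_one_of_mem_divisorLefschetzGroup_coe_eq_aeval`) and is determined by its sign vector
  (`eq_of_coe_eq_aeval_of_forall_eval_eq`): at most `2^{#Σ}` such elements.

NOT here: the factor groups as algebraic groups, their types (`Sp_{2k}`, `O_k`, `GL_k`: Table 2), `Δ`, `e₀ = [E₀:ℚ]`,
the inclusion `Z(G_div) ⊆ U_{K_B}` of Lemma (1) (needs `End(V_X)^{G_div} = B`, Lemma (3)), connectedness / rank of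
the torus.

## References

* [MoonenZarhin1998WeilClasses] B. J. J. Moonen, Yu. G. Zarhin, J. reine angew. Math. 496 (1998) =
  arXiv:alg-geom/9612017, §1 (chunk p0002 L86–L100: the splitting of `SP ⊗ ℂ`, `Δ ⊗ ℂ`, `G_div ⊗ ℂ` over `Σ_{E₀}`;
  L121–L127: Lemma (1) «the center of `G_div(X)` is the group `U_{K_B}` … `U_{K_B}(R) = {a ∈ (K_B ⊗_ℚ R)^* | a a† = 1}`.
  For `X` of type 4 with either `d ≥ 2` or `m ≥ 2` this is a connected torus of rank `e₀`; in all other cases it is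
  finite»).
* [Milne1999LefschetzClasses] J. S. Milne, Duke Math. J. 96 (1999), §2 pp. 645–647 (decomposition of `C(A) ⊗ k`,
  `S(A)` over the embeddings of the centre).
* [LangeBirkenhake1992] H. Lange, Ch. Birkenhake, *Complex Abelian Varieties*, §5.1 (Rosati = adjoint), §5.5
  (the centre and its totally real subfield).

## Provenance

Lane `lit-hodgefound` (Track 2, Layer A), prover seat `lit-hodgefound-p21` (generation 14), row g14-#5.
-/

noncomputable section

open CategoryTheory Polynomial Module

namespace Literature.AlgebraicGeometry.HodgeTheory

open Literature.AlgebraicGeometry.Motives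
open Literature.AlgebraicGeometry.VanGeemen1994 (hodgeClassSpan pullbackOne)
open Literature.AlgebraicGeometry.Milne1999 (centralizerAlgebra centralizerGroup unitaryCentralizerGroup
  mem_centralizerAlgebra_iff' mem_centralizerGroup_iff)
open Literature.AlgebraicTopology.SingularHomology

section HodgeTheory

variable {A : AbelianVariety ℂ} {h : complexBetti A.X 2} {ζ : A ⟶ A} {P : Polynomial ℤ}
  {u : complexBetti A.X 1 ≃ₗ[ℂ] complexBetti A.X 1}

/-! ### §1 `H¹(A(ℂ); ℂ) = ⊕_τ V^{(τ)}` for the pull-back of an endomorphism with irreducible minimal polynomial -/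

/-- **`H¹(A(ℂ); ℂ) = ⨆_τ ker(ζ^* - τ)`** when `P(ζ) = 0` for an irreducible `P ∈ ℤ[T]` (an eigenbasis of `ζ^*`, the
tree's `exists_eigenbasis_complexBetti_one`): the decomposition `V_ℂ = ⊕_{τ ∈ Σ} V^{(τ)}` over the complex embeddings
of `ℚ(ζ)`. [cite: MoonenZarhin1998WeilClasses, §1 (V_ℂ = ⊕_σ V_{ℂ,σ}, chunk p0001; SP ⊗ ℂ = ∏_τ, chunk p0002 L86–L100)] -/
theorem iSup_eigenspace_pullbackOne_eq_top (hPirr : Irreducible (P.map (Int.castRingHom ℚ)))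
    (hζ : Polynomial.eval₂ (Int.castRingHom (CategoryTheory.End A)) (ζ : CategoryTheory.End A) P = 0) :
    ⨆ τ : ℂ, Module.End.eigenspace (pullbackOne A ζ) τ = ⊤ := by
  classical
  obtain ⟨N, b, lam, -, hb⟩ := exists_eigenbasis_complexBetti_one hPirr hζ
  rw [eq_top_iff, ← b.span_eq, Submodule.span_le]
  rintro _ ⟨i, rfl⟩
  exact Submodule.mem_iSup_of_mem (lam i) (hb i)

/-- Every `x ∈ H¹(A(ℂ); ℂ)` lies in `⨆_τ V^{(τ)}` (§1 restated for use with `Submodule.iSup_induction`).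
[cite: MoonenZarhin1998WeilClasses, §1 (chunk p0002 L86–L100)] -/
theorem mem_iSup_eigenspace_pullbackOne (hPirr : Irreducible (P.map (Int.castRingHom ℚ)))
    (hζ : Polynomial.eval₂ (Int.castRingHom (CategoryTheory.End A)) (ζ : CategoryTheory.End A) P = 0)
    (x : complexBetti A.X 1) : x ∈ ⨆ τ : ℂ, Module.End.eigenspace (pullbackOne A ζ) τ := by
  rw [iSup_eigenspace_pullbackOne_eq_top hPirr hζ]; exact Submodule.mem_top

/-- **A linear map of `H¹(A(ℂ); ℂ)` is determined by its blocks**: two endomorphisms agreeing on every `V^{(τ)}` are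
equal (`H¹ = ⊕_τ V^{(τ)}`) — the injectivity half of «`End(V_ℂ) ⊇ ∏_τ End(V^{(τ)})`».
[cite: MoonenZarhin1998WeilClasses, §1 (chunk p0002 L86–L100)] -/
theorem eq_of_forall_eigenspace_apply_eq (hPirr : Irreducible (P.map (Int.castRingHom ℚ)))
    (hζ : Polynomial.eval₂ (Int.castRingHom (CategoryTheory.End A)) (ζ : CategoryTheory.End A) P = 0)
    {f g : Module.End ℂ (complexBetti A.X 1)}
    (hfg : ∀ (τ : ℂ), ∀ x ∈ Module.End.eigenspace (pullbackOne A ζ) τ, f x = g x) : f = g := by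
  refine LinearMap.ext fun x ↦ ?_
  refine Submodule.iSup_induction (motive := fun x ↦ f x = g x) _ (mem_iSup_eigenspace_pullbackOne hPirr hζ x)
    hfg (by simp) fun x y hx hy ↦ ?_
  rw [map_add, map_add, hx, hy]

/-- Blockwise ⟹ global commutation: if `u ∘ T = T ∘ u` on every `V^{(τ)}`, then `u ∘ T = T ∘ u`.
[cite: MoonenZarhin1998WeilClasses, §1 (chunk p0002 L86–L100)] -/
theorem apply_apply_eq_of_forall_eigenspace (hPirr : Irreducible (P.map (Int.castRingHom ℚ)))
    (hζ : Polynomial.eval₂ (Int.castRingHom (CategoryTheory.End A)) (ζ : CategoryTheory.End A) P = 0)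
    {T : Module.End ℂ (complexBetti A.X 1)}
    (hcomm : ∀ (τ : ℂ), ∀ x ∈ Module.End.eigenspace (pullbackOne A ζ) τ, u (T x) = T (u x))
    (x : complexBetti A.X 1) : u (T x) = T (u x) := by
  have key := eq_of_forall_eigenspace_apply_eq hPirr hζ (f := (u : _ →ₗ[ℂ] _) ∘ₗ T)
    (g := T ∘ₗ (u : _ →ₗ[ℂ] _)) fun τ x hx ↦ by simpa using hcomm τ x hx
  simpa using LinearMap.congr_fun key x

/-! ### §2 The eigenspaces `V^{(τ)}`: stability under `G_div(X)(ℂ)` and under the pull-backs, `Q_h`-orthogonality -/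

/-- A `Q_h`-self-adjoint pull-back `ζ^*` lies in `S_λ ⊗ ℂ`. [cite: MoonenZarhin1998WeilClasses, §1 (definition of S_λ; chunk p0002)] -/
theorem pullbackOne_mem_symmetricPullbackSpan
    (hsym : ∀ x y : complexBetti A.X 1, polarizationPairingOne A.X h (A.dim - 1) (pullbackOne A ζ x) y =
      polarizationPairingOne A.X h (A.dim - 1) x (pullbackOne A ζ y)) :
    pullbackOne A ζ ∈ symmetricPullbackSpan A h :=
  ⟨Submodule.subset_span ⟨ζ, rfl⟩, hsym⟩

/-- **An automorphism commuting with `ζ^*` preserves its eigenspaces.** [folklore] -/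
private theorem apply_mem_eigenspace_of_comm (hcomm : ∀ x, u (pullbackOne A ζ x) = pullbackOne A ζ (u x)) {τ : ℂ}
    {x : complexBetti A.X 1} (hx : x ∈ Module.End.eigenspace (pullbackOne A ζ) τ) :
    u x ∈ Module.End.eigenspace (pullbackOne A ζ) τ := by
  rw [Module.End.mem_eigenspace_iff] at hx ⊢
  rw [← hcomm x, hx, map_smul]

/-- **Every `u ∈ G_div(X)(ℂ)` preserves the eigenspaces `V^{(τ)} = ker(ζ^* - τ)` of a `†`-symmetric pull-back `ζ^*`**
(`u` commutes with `ζ^* ∈ S_λ ⊗ ℂ`). [cite: MoonenZarhin1998WeilClasses, §1 (G_div ⊗ ℂ = ∏_τ G_div^{(τ)}; chunk p0002 L86–L100)] -/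
theorem apply_mem_eigenspace_of_mem_divisorLefschetzGroup
    (hsym : ∀ x y : complexBetti A.X 1, polarizationPairingOne A.X h (A.dim - 1) (pullbackOne A ζ x) y =
      polarizationPairingOne A.X h (A.dim - 1) x (pullbackOne A ζ y))
    (hu : u ∈ divisorLefschetzGroup A h) {τ : ℂ} {x : complexBetti A.X 1}
    (hx : x ∈ Module.End.eigenspace (pullbackOne A ζ) τ) :
    u x ∈ Module.End.eigenspace (pullbackOne A ζ) τ :=
  apply_mem_eigenspace_of_comm (fun x ↦ hu.1 _ (pullbackOne_mem_symmetricPullbackSpan hsym) x) hx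

/-- **Every `u ∈ G_div(X)(ℂ)` preserves the eigenspaces of a pull-back `ζ^* ∈ B ⊗ ℂ`** (the subalgebra generated by
`S_λ ⊗ ℂ`; `G_div(X)(ℂ)` centralizes `B ⊗ ℂ`, `divisorLefschetzGroup_comm_of_mem_adjoin`) — e.g. `ζ ∈ K_B = Z(B)`.
[cite: MoonenZarhin1998WeilClasses, §1 Lemma (1) (chunk p0002 L121–L124)] -/
theorem apply_mem_eigenspace_of_mem_divisorLefschetzGroup_of_mem_adjoin
    (hζB : pullbackOne A ζ ∈ Algebra.adjoin ℂ (symmetricPullbackSpan A h : Set (Module.End ℂ (complexBetti A.X 1))))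
    (hu : u ∈ divisorLefschetzGroup A h) {τ : ℂ} {x : complexBetti A.X 1}
    (hx : x ∈ Module.End.eigenspace (pullbackOne A ζ) τ) :
    u x ∈ Module.End.eigenspace (pullbackOne A ζ) τ :=
  apply_mem_eigenspace_of_comm (fun x ↦ divisorLefschetzGroup_comm_of_mem_adjoin hu hζB x) hx

/-- `p(f)` acts on the eigenspace `ker(f - μ)` as the scalar `p(μ)` (Mathlib's `aeval_apply_of_hasEigenvector`, including
`x = 0`). [folklore] -/
private theorem aeval_apply_of_mem_eigenspace {M : Type*} [AddCommGroup M] [Module ℂ M] {f : Module.End ℂ M}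
    {μ : ℂ} {x : M} (hx : x ∈ Module.End.eigenspace f μ) (p : ℂ[X]) : aeval f p x = p.eval μ • x := by
  by_cases hx0 : x = 0
  · simp [hx0]
  · exact Module.End.aeval_apply_of_hasEigenvector ⟨hx, hx0⟩

/-- `p(ζ^*)` preserves every eigenspace of `ζ^*`. [folklore] -/
private theorem aeval_pullbackOne_apply_mem_eigenspace (p : ℂ[X]) {τ : ℂ} {x : complexBetti A.X 1}
    (hx : x ∈ Module.End.eigenspace (pullbackOne A ζ) τ) :
    aeval (pullbackOne A ζ) p x ∈ Module.End.eigenspace (pullbackOne A ζ) τ := by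
  rw [aeval_apply_of_mem_eigenspace hx]
  exact Submodule.smul_mem _ _ hx

/-- **`Q_h`-orthogonality of eigenspaces relative to the Rosati conjugate.**  If `Q_h(ζ^* x, y) = Q_h(x, q(ζ^*) y)`
(`ζ† = q(ζ)`: e.g. `q = T` for `ζ ∈ E₀` totally real, `q` = complex conjugation of the CM field `E = ℚ(ζ)` in type IV),
then `Q_h(V^{(τ)}, V^{(τ′)}) = 0` unless `τ = q(τ′)` (`τ Q_h(x, y) = q(τ′) Q_h(x, y)`): the form pairs `V^{(τ′)}` only
with `V^{(q(τ′))}` (the tree's `Milne1999.polarizationPairingOne_eq_zero_of_mem_eigenspace_of_adjoint` is the case of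
an adjoint PAIR `ψ, ψ′`; restated for a polynomial conjugate to keep the import closure small).
[cite: MoonenZarhin1998WeilClasses, §1 (chunk p0002 L86–L92, L121–L124)] [cite: Milne1999LefschetzClasses, §2 p. 650]
[cite: LangeBirkenhake1992, §5.1, Thm. 5.5.6] -/
theorem polarizationPairingOne_eq_zero_of_mem_eigenspace_of_ne_eval {q : ℂ[X]}
    (hadj : ∀ x y : complexBetti A.X 1, polarizationPairingOne A.X h (A.dim - 1) (pullbackOne A ζ x) y =
      polarizationPairingOne A.X h (A.dim - 1) x (aeval (pullbackOne A ζ) q y))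
    {τ τ' : ℂ} (hne : τ ≠ q.eval τ') {x y : complexBetti A.X 1} (hx : x ∈ Module.End.eigenspace (pullbackOne A ζ) τ)
    (hy : y ∈ Module.End.eigenspace (pullbackOne A ζ) τ') :
    polarizationPairingOne A.X h (A.dim - 1) x y = 0 := by
  have e := hadj x y
  rw [Module.End.mem_eigenspace_iff] at hx
  rw [hx, aeval_apply_of_mem_eigenspace hy, map_smul, LinearMap.smul_apply, map_smul] at e
  rw [← sub_eq_zero, ← sub_smul, smul_eq_zero, sub_eq_zero] at e
  exact e.resolve_left hne

/-- **The eigenspaces of a `†`-symmetric `ζ^*` are mutually `Q_h`-orthogonal**: `Q_h(x, y) = 0` for `x ∈ V^{(τ)}`,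
`y ∈ V^{(τ′)}`, `τ ≠ τ′` — «`SP(V, φ) ⊗ ℂ = ∏_τ SP(V^{(τ)}, φ^{(τ)})`».
[cite: MoonenZarhin1998WeilClasses, §1 (chunk p0002 L86–L92)] [cite: LangeBirkenhake1992, §5.1] -/
theorem polarizationPairingOne_eq_zero_of_mem_eigenspace_of_ne
    (hsym : ∀ x y : complexBetti A.X 1, polarizationPairingOne A.X h (A.dim - 1) (pullbackOne A ζ x) y =
      polarizationPairingOne A.X h (A.dim - 1) x (pullbackOne A ζ y))
    {τ τ' : ℂ} (hne : τ ≠ τ') {x y : complexBetti A.X 1} (hx : x ∈ Module.End.eigenspace (pullbackOne A ζ) τ)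
    (hy : y ∈ Module.End.eigenspace (pullbackOne A ζ) τ') :
    polarizationPairingOne A.X h (A.dim - 1) x y = 0 :=
  polarizationPairingOne_eq_zero_of_mem_eigenspace_of_ne_eval (q := X) (fun x y ↦ by simpa using hsym x y)
    (by simpa using hne) hx hy

/-- **`ζ^*` commutes with every `ℂ`-combination of pull-backs when `ζ` is CENTRAL** (`ζ^* ∈ C(A) ⊗ ℂ`).
[cite: Milne1999LefschetzClasses, §1 p. 642, §2 p. 645] -/
theorem pullbackOne_apply_eq_of_mem_span_pullbackOne (hζC : pullbackOne A ζ ∈ centralizerAlgebra A)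
    {T : Module.End ℂ (complexBetti A.X 1)} (hT : T ∈ Submodule.span ℂ (Set.range fun φ : A ⟶ A ↦ pullbackOne A φ))
    (y : complexBetti A.X 1) : pullbackOne A ζ (T y) = T (pullbackOne A ζ y) := by
  induction hT using Submodule.span_induction generalizing y with
  | mem S hS =>
    obtain ⟨φ, rfl⟩ := hS
    exact (mem_centralizerAlgebra_iff'.1 hζC) φ y
  | zero => simp
  | add S S' _ _ hS hS' => rw [LinearMap.add_apply, LinearMap.add_apply, map_add, hS, hS']
  | smul r S _ hS => rw [LinearMap.smul_apply, LinearMap.smul_apply, map_smul, hS]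

/-- **Every `ℂ`-combination of pull-backs (`End⁰(X) ⊗ ℂ` acting) preserves the eigenspaces of a CENTRAL `ζ^*`** —
«`Δ ⊗ ℂ = ∏_τ Δ^{(τ)}_ℂ`», «`C(A) ⊗ k = ∏_σ End(V_σ)`-blocks».
[cite: MoonenZarhin1998WeilClasses, §1 (chunk p0002 L86–L95)] [cite: Milne1999LefschetzClasses, §2 p. 645] -/
theorem apply_mem_eigenspace_of_mem_span_pullbackOne (hζC : pullbackOne A ζ ∈ centralizerAlgebra A)
    {T : Module.End ℂ (complexBetti A.X 1)} (hT : T ∈ Submodule.span ℂ (Set.range fun φ : A ⟶ A ↦ pullbackOne A φ))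
    {τ : ℂ} {x : complexBetti A.X 1} (hx : x ∈ Module.End.eigenspace (pullbackOne A ζ) τ) :
    T x ∈ Module.End.eigenspace (pullbackOne A ζ) τ := by
  rw [Module.End.mem_eigenspace_iff] at hx ⊢
  rw [pullbackOne_apply_eq_of_mem_span_pullbackOne hζC hT, hx, map_smul]

/-- **`S_λ ⊗ ℂ` preserves the eigenspaces of a central `ζ^*`.** [cite: MoonenZarhin1998WeilClasses, §1 (chunk p0002 L86–L95)] -/
theorem apply_mem_eigenspace_of_mem_symmetricPullbackSpan (hζC : pullbackOne A ζ ∈ centralizerAlgebra A)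
    {T : Module.End ℂ (complexBetti A.X 1)} (hT : T ∈ symmetricPullbackSpan A h)
    {τ : ℂ} {x : complexBetti A.X 1} (hx : x ∈ Module.End.eigenspace (pullbackOne A ζ) τ) :
    T x ∈ Module.End.eigenspace (pullbackOne A ζ) τ :=
  apply_mem_eigenspace_of_mem_span_pullbackOne hζC hT.1 hx

/-- **Blockwise ⟹ global `Q_h`-invariance, relative to a Rosati-conjugate polynomial.**  If
`Q_h(ζ^* x, y) = Q_h(x, q(ζ^*) y)`, an endomorphism `f` preserving every eigenspace `V^{(τ)}` of `ζ^*` (`P(ζ) = 0`,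
`P` irreducible) and preserving `Q_h` on each PAIRED couple `V^{(q(τ′))} × V^{(τ′)}` preserves `Q_h`: all other cross
terms vanish on both sides (orthogonality). [cite: MoonenZarhin1998WeilClasses, §1 (chunk p0002 L86–L92)]
[cite: Milne1999LefschetzClasses, §2 p. 650 (V_σ pairs with V_{σ̄})] -/
theorem polarizationPairingOne_map_eq_of_forall_eigenspace_of_adjoint (hPirr : Irreducible (P.map (Int.castRingHom ℚ)))
    (hζ : Polynomial.eval₂ (Int.castRingHom (CategoryTheory.End A)) (ζ : CategoryTheory.End A) P = 0) {q : ℂ[X]}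
    (hadj : ∀ x y : complexBetti A.X 1, polarizationPairingOne A.X h (A.dim - 1) (pullbackOne A ζ x) y =
      polarizationPairingOne A.X h (A.dim - 1) x (aeval (pullbackOne A ζ) q y))
    {f : Module.End ℂ (complexBetti A.X 1)}
    (hstab : ∀ (τ : ℂ), ∀ x ∈ Module.End.eigenspace (pullbackOne A ζ) τ,
      f x ∈ Module.End.eigenspace (pullbackOne A ζ) τ)
    (hQ : ∀ (τ τ' : ℂ), τ = q.eval τ' → ∀ x ∈ Module.End.eigenspace (pullbackOne A ζ) τ,
      ∀ y ∈ Module.End.eigenspace (pullbackOne A ζ) τ',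
      polarizationPairingOne A.X h (A.dim - 1) (f x) (f y) = polarizationPairingOne A.X h (A.dim - 1) x y)
    (x y : complexBetti A.X 1) :
    polarizationPairingOne A.X h (A.dim - 1) (f x) (f y) = polarizationPairingOne A.X h (A.dim - 1) x y := by
  revert y
  refine Submodule.iSup_induction
    (motive := fun x ↦ ∀ y, polarizationPairingOne A.X h (A.dim - 1) (f x) (f y) =
      polarizationPairingOne A.X h (A.dim - 1) x y) _ (mem_iSup_eigenspace_pullbackOne hPirr hζ x)
    (fun τ x hx y ↦ ?_) (fun y ↦ by simp) fun x x' hx hx' y ↦ ?_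
  · refine Submodule.iSup_induction
      (motive := fun y ↦ polarizationPairingOne A.X h (A.dim - 1) (f x) (f y) =
        polarizationPairingOne A.X h (A.dim - 1) x y) _ (mem_iSup_eigenspace_pullbackOne hPirr hζ y)
      (fun τ' y hy ↦ ?_) (by simp) fun y y' hy hy' ↦ ?_
    · by_cases hτ : τ = q.eval τ'
      · exact hQ τ τ' hτ x hx y hy
      · rw [polarizationPairingOne_eq_zero_of_mem_eigenspace_of_ne_eval hadj hτ hx hy,
          polarizationPairingOne_eq_zero_of_mem_eigenspace_of_ne_eval hadj hτ (hstab τ x hx) (hstab τ' y hy)]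
    · rw [map_add, map_add, map_add, hy, hy']
  · rw [map_add, map_add, LinearMap.add_apply, map_add, LinearMap.add_apply, hx y, hx' y]

/-- **Blockwise ⟹ global `Q_h`-invariance** for a `†`-symmetric `ζ^*`: if `u` preserves every eigenspace `V^{(τ)}`
(`P(ζ) = 0`, `P` irreducible) and preserves `Q_h` on each `V^{(τ)} × V^{(τ)}`, then `u` preserves `Q_h` — the
cross terms vanish on both sides by the orthogonality of the eigenspaces («`SP(V, φ) ⊗ ℂ = ∏_τ SP(V^{(τ)}, φ^{(τ)})`»).
[cite: MoonenZarhin1998WeilClasses, §1 (chunk p0002 L86–L92)] -/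
theorem polarizationPairingOne_map_eq_of_forall_eigenspace (hPirr : Irreducible (P.map (Int.castRingHom ℚ)))
    (hζ : Polynomial.eval₂ (Int.castRingHom (CategoryTheory.End A)) (ζ : CategoryTheory.End A) P = 0)
    (hsym : ∀ x y : complexBetti A.X 1, polarizationPairingOne A.X h (A.dim - 1) (pullbackOne A ζ x) y =
      polarizationPairingOne A.X h (A.dim - 1) x (pullbackOne A ζ y))
    (hstab : ∀ (τ : ℂ), ∀ x ∈ Module.End.eigenspace (pullbackOne A ζ) τ,
      u x ∈ Module.End.eigenspace (pullbackOne A ζ) τ)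
    (hQ : ∀ (τ : ℂ), ∀ x ∈ Module.End.eigenspace (pullbackOne A ζ) τ, ∀ y ∈ Module.End.eigenspace (pullbackOne A ζ) τ,
      polarizationPairingOne A.X h (A.dim - 1) (u x) (u y) = polarizationPairingOne A.X h (A.dim - 1) x y)
    (x y : complexBetti A.X 1) :
    polarizationPairingOne A.X h (A.dim - 1) (u x) (u y) = polarizationPairingOne A.X h (A.dim - 1) x y :=
  polarizationPairingOne_map_eq_of_forall_eigenspace_of_adjoint hPirr hζ (q := X) (f := (u : _ →ₗ[ℂ] _))
    (fun x y ↦ by simpa using hsym x y) hstab (fun τ τ' e ↦ by rw [eval_X] at e; subst e; exact hQ τ) x y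

/-! ### §3 «`G_div(X) ⊗ ℂ` splits as the direct product of the factors `G_div^{(τ)}`» -/

/-- **MOONEN–ZARHIN §1: «`G_div(X) ⊗ ℂ` splits as the direct product of `e₀` factors `G_div^{(τ)}`», PROVED on the
carrier in blockwise form.**  Let `ζ ∈ End(A)` be `†`-symmetric (`Q_h(ζ^* x, y) = Q_h(x, ζ^* y)`) with `P(ζ) = 0`,
`P ∈ ℤ[T]` irreducible, and `V^{(τ)} = ker(ζ^* - τ)`. Then an automorphism `u` of `H¹(A(ℂ); ℂ)` lies in
`G_div(X)(ℂ) = divisorLefschetzGroup A h` IF AND ONLY IF `u` preserves every `V^{(τ)}` and, for every `τ` separately,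
commutes with `S_λ ⊗ ℂ` on `V^{(τ)}` and preserves `Q_h` on `V^{(τ)} × V^{(τ)}`: the conditions defining `G_div(X)(ℂ)`
decouple along `H¹ = ⊕_τ V^{(τ)}` (§1) because `Q_h` is an orthogonal sum over the `V^{(τ)}` (§2). For the print's
CENTRAL `ζ` (a generator of the totally real field `E₀ ⊆ Z(End⁰(X))`) `S_λ ⊗ ℂ` moreover preserves each `V^{(τ)}`
(`apply_mem_eigenspace_of_mem_symmetricPullbackSpan`), so that the `τ`-th condition is a condition on the block
`u|_{V^{(τ)}} ∈ GL(V^{(τ)})` alone — the factor `G_div^{(τ)}`; centrality is not needed for the equivalence itself.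
[cite: MoonenZarhin1998WeilClasses, §1 (chunk p0002 L86–L100)] [cite: Milne1999LefschetzClasses, §2 pp. 645–647] -/
theorem mem_divisorLefschetzGroup_iff_forall_eigenspace (hPirr : Irreducible (P.map (Int.castRingHom ℚ)))
    (hζ : Polynomial.eval₂ (Int.castRingHom (CategoryTheory.End A)) (ζ : CategoryTheory.End A) P = 0)
    (hsym : ∀ x y : complexBetti A.X 1, polarizationPairingOne A.X h (A.dim - 1) (pullbackOne A ζ x) y =
      polarizationPairingOne A.X h (A.dim - 1) x (pullbackOne A ζ y)) :
    u ∈ divisorLefschetzGroup A h ↔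
      (∀ (τ : ℂ), ∀ x ∈ Module.End.eigenspace (pullbackOne A ζ) τ, u x ∈ Module.End.eigenspace (pullbackOne A ζ) τ) ∧
      ∀ τ : ℂ,
        (∀ T ∈ symmetricPullbackSpan A h, ∀ x ∈ Module.End.eigenspace (pullbackOne A ζ) τ, u (T x) = T (u x)) ∧
        ∀ x ∈ Module.End.eigenspace (pullbackOne A ζ) τ, ∀ y ∈ Module.End.eigenspace (pullbackOne A ζ) τ,
          polarizationPairingOne A.X h (A.dim - 1) (u x) (u y) = polarizationPairingOne A.X h (A.dim - 1) x y := by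
  refine ⟨fun hu ↦ ⟨fun τ x hx ↦ apply_mem_eigenspace_of_mem_divisorLefschetzGroup hsym hu hx,
    fun τ ↦ ⟨fun T hT x _ ↦ hu.1 T hT x, fun x _ y _ ↦ hu.2 x y⟩⟩, fun ⟨hstab, hblock⟩ ↦ ⟨fun T hT x ↦ ?_, fun x y ↦ ?_⟩⟩
  · exact apply_apply_eq_of_forall_eigenspace hPirr hζ (fun τ x hx ↦ (hblock τ).1 T hT x hx) x
  · exact polarizationPairingOne_map_eq_of_forall_eigenspace hPirr hζ hsym hstab (fun τ ↦ (hblock τ).2) x y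

/-! ### §4 The same splitting for Milne's `S(A)(h)(ℂ)` (centralizer of ALL pull-backs in `Sp(Q_h)`) -/

/-- **Every `u ∈ S(A)(h)(ℂ)` preserves the eigenspaces of a pull-back `ζ^*`** (it commutes with `ζ^*`).
[cite: Milne1999LefschetzClasses, §2 pp. 645–647] -/
theorem apply_mem_eigenspace_of_mem_unitaryCentralizerGroup (hu : u ∈ unitaryCentralizerGroup A h) {τ : ℂ}
    {x : complexBetti A.X 1} (hx : x ∈ Module.End.eigenspace (pullbackOne A ζ) τ) :
    u x ∈ Module.End.eigenspace (pullbackOne A ζ) τ :=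
  apply_mem_eigenspace_of_comm (fun x ↦ (mem_centralizerGroup_iff.1 hu.1) ζ x) hx

/-- **Milne's `S(A)(h)(ℂ)` splits along the eigenspaces of a `†`-symmetric `ζ^*`** (Milne 1999 §2: `S(A)` over
the embeddings of the centre; Moonen–Zarhin's `SP(V, φ) ⊗ ℂ = ∏_τ SP(V^{(τ)}, φ^{(τ)})`): `u ∈ unitaryCentralizerGroup A h`
iff `u` preserves every `V^{(τ)}` and, blockwise, commutes with every pull-back and preserves `Q_h` (for a CENTRAL `ζ`
every pull-back preserves the blocks, `apply_mem_eigenspace_of_mem_span_pullbackOne`, so these are conditions on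
`u|_{V^{(τ)}}` alone).
[cite: Milne1999LefschetzClasses, §2 pp. 645–647] [cite: MoonenZarhin1998WeilClasses, §1 (chunk p0002 L86–L100)] -/
theorem mem_unitaryCentralizerGroup_iff_forall_eigenspace (hPirr : Irreducible (P.map (Int.castRingHom ℚ)))
    (hζ : Polynomial.eval₂ (Int.castRingHom (CategoryTheory.End A)) (ζ : CategoryTheory.End A) P = 0)
    (hsym : ∀ x y : complexBetti A.X 1, polarizationPairingOne A.X h (A.dim - 1) (pullbackOne A ζ x) y =
      polarizationPairingOne A.X h (A.dim - 1) x (pullbackOne A ζ y)) :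
    u ∈ unitaryCentralizerGroup A h ↔
      (∀ (τ : ℂ), ∀ x ∈ Module.End.eigenspace (pullbackOne A ζ) τ, u x ∈ Module.End.eigenspace (pullbackOne A ζ) τ) ∧
      ∀ τ : ℂ,
        (∀ (φ : A ⟶ A), ∀ x ∈ Module.End.eigenspace (pullbackOne A ζ) τ, u (pullbackOne A φ x) = pullbackOne A φ (u x)) ∧
        ∀ x ∈ Module.End.eigenspace (pullbackOne A ζ) τ, ∀ y ∈ Module.End.eigenspace (pullbackOne A ζ) τ,
          polarizationPairingOne A.X h (A.dim - 1) (u x) (u y) = polarizationPairingOne A.X h (A.dim - 1) x y := by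
  refine ⟨fun hu ↦ ⟨fun τ x hx ↦ apply_mem_eigenspace_of_mem_unitaryCentralizerGroup hu hx,
    fun τ ↦ ⟨fun φ x _ ↦ (mem_centralizerGroup_iff.1 hu.1) φ x, fun x _ y _ ↦ hu.2 x y⟩⟩,
    fun ⟨hstab, hblock⟩ ↦ ⟨mem_centralizerGroup_iff.2 fun φ x ↦ ?_, fun x y ↦ ?_⟩⟩
  · exact apply_apply_eq_of_forall_eigenspace hPirr hζ (fun τ x hx ↦ (hblock τ).1 φ x hx) x
  · exact polarizationPairingOne_map_eq_of_forall_eigenspace hPirr hζ hsym hstab (fun τ ↦ (hblock τ).2) x y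

/-! ### §5 Lemma (1) «`Z(G_div(X)) = U_{K_B}`, `U_{K_B}(R) = {a ∈ (K_B ⊗ R)^* | a a† = 1}`»: the elements
`a = p(ζ^*)`, `a a† = 1`, of a `†`-stable central field `ℚ(ζ)` lie in `G_div(X)(ℂ)` (and in `S(A)(h)(ℂ)`) -/

/-- `p(ζ^*)` commutes with every `ℂ`-combination of pull-backs when `ζ` is central. [cite: Milne1999LefschetzClasses, §2 p. 645] -/
theorem aeval_pullbackOne_apply_eq_of_mem_span_pullbackOne (hPirr : Irreducible (P.map (Int.castRingHom ℚ)))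
    (hζ : Polynomial.eval₂ (Int.castRingHom (CategoryTheory.End A)) (ζ : CategoryTheory.End A) P = 0)
    (hζC : pullbackOne A ζ ∈ centralizerAlgebra A) {T : Module.End ℂ (complexBetti A.X 1)}
    (hT : T ∈ Submodule.span ℂ (Set.range fun φ : A ⟶ A ↦ pullbackOne A φ)) (p : ℂ[X]) (x : complexBetti A.X 1) :
    aeval (pullbackOne A ζ) p (T x) = T (aeval (pullbackOne A ζ) p x) := by
  have key := eq_of_forall_eigenspace_apply_eq hPirr hζ (f := aeval (pullbackOne A ζ) p ∘ₗ T)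
    (g := T ∘ₗ aeval (pullbackOne A ζ) p) fun τ x hx ↦ by
      rw [LinearMap.comp_apply, LinearMap.comp_apply, aeval_apply_of_mem_eigenspace hx, map_smul,
        aeval_apply_of_mem_eigenspace (apply_mem_eigenspace_of_mem_span_pullbackOne hζC hT hx)]
  exact LinearMap.congr_fun key x

/-- **`a a† = 1` on the carrier**: if `p(τ) · p(q(τ)) = 1` at every eigenvalue `τ` of `ζ^*` (`P(ζ) = 0`, `P`
irreducible), then `p(ζ^*) · (p ∘ q)(ζ^*) = 1` — for `ζ† = q(ζ)`, `(p ∘ q)(ζ^*) = p(ζ†^*)` is `a†` for `a = p(ζ^*)`.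
[cite: MoonenZarhin1998WeilClasses, §1 Lemma (1) (chunk p0002 L121–L124)] -/
theorem aeval_pullbackOne_mul_aeval_comp_eq_one (hPirr : Irreducible (P.map (Int.castRingHom ℚ)))
    (hζ : Polynomial.eval₂ (Int.castRingHom (CategoryTheory.End A)) (ζ : CategoryTheory.End A) P = 0) (p q : ℂ[X])
    (hp : ∀ τ : ℂ, Module.End.HasEigenvalue (pullbackOne A ζ) τ → p.eval τ * p.eval (q.eval τ) = 1) :
    aeval (pullbackOne A ζ) p * aeval (pullbackOne A ζ) (p.comp q) = 1 := by
  refine eq_of_forall_eigenspace_apply_eq hPirr hζ fun τ x hx ↦ ?_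
  by_cases hx0 : x = 0
  · simp [hx0]
  · have key := hp τ (Module.End.hasEigenvalue_of_hasEigenvector ⟨hx, hx0⟩)
    rw [Module.End.mul_apply, aeval_apply_of_mem_eigenspace hx, map_smul, aeval_apply_of_mem_eigenspace hx, smul_smul,
      eval_comp, Module.End.one_apply]
    first
    | rw [key, one_smul]
    | (rw [mul_comm] at key; rw [key, one_smul])

/-- The symmetric companion: `(p ∘ q)(ζ^*) · p(ζ^*) = 1` (polynomials in `ζ^*` commute).
[cite: MoonenZarhin1998WeilClasses, §1 Lemma (1) (chunk p0002 L121–L124)] -/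
theorem aeval_comp_mul_aeval_pullbackOne_eq_one (hPirr : Irreducible (P.map (Int.castRingHom ℚ)))
    (hζ : Polynomial.eval₂ (Int.castRingHom (CategoryTheory.End A)) (ζ : CategoryTheory.End A) P = 0) (p q : ℂ[X])
    (hp : ∀ τ : ℂ, Module.End.HasEigenvalue (pullbackOne A ζ) τ → p.eval τ * p.eval (q.eval τ) = 1) :
    aeval (pullbackOne A ζ) (p.comp q) * aeval (pullbackOne A ζ) p = 1 := by
  rw [← map_mul, mul_comm, map_mul]
  exact aeval_pullbackOne_mul_aeval_comp_eq_one hPirr hζ p q hp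

/-- `p(ζ^*)² = 1` when `p(τ)² = 1` at every eigenvalue: the SIGN ELEMENT acting as `p(τ) = ±1` on `V^{(τ)}`.
[cite: MoonenZarhin1998WeilClasses, §1 Lemma (1) (chunk p0002 L121–L124)] -/
theorem aeval_pullbackOne_mul_self_eq_one (hPirr : Irreducible (P.map (Int.castRingHom ℚ)))
    (hζ : Polynomial.eval₂ (Int.castRingHom (CategoryTheory.End A)) (ζ : CategoryTheory.End A) P = 0) (p : ℂ[X])
    (hp : ∀ τ : ℂ, Module.End.HasEigenvalue (pullbackOne A ζ) τ → p.eval τ ^ 2 = 1) :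
    aeval (pullbackOne A ζ) p * aeval (pullbackOne A ζ) p = 1 := by
  have := aeval_pullbackOne_mul_aeval_comp_eq_one hPirr hζ p X fun τ hτ ↦ by rw [eval_X, ← sq]; exact hp τ hτ
  rwa [comp_X] at this

/-- **MOONEN–ZARHIN §1 LEMMA (1), the elements: «`U_{K_B}(R) = {a ∈ (K_B ⊗_ℚ R)^* | a a† = 1}`» lie in `G_div(X)(ℂ)`.**
Let `ζ ∈ End(A)` be CENTRAL (`ζ^* ∈ C(A) ⊗ ℂ`) with `P(ζ) = 0`, `P ∈ ℤ[T]` irreducible, and with Rosati conjugate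
a polynomial in `ζ`: `Q_h(ζ^* x, y) = Q_h(x, q(ζ^*) y)` (`ζ† = q(ζ)`; `q = T` on the totally real `E₀`, `q` =
complex conjugation on a CM centre `E`). Then for every `p ∈ ℂ[T]` with `p(τ) · p(q(τ)) = 1` at each eigenvalue `τ`
of `ζ^*` — i.e. `a a† = 1` for `a = p(ζ^*) ∈ (ℚ(ζ) ⊗ ℂ)^*`, acting as `p(τ)` on `V^{(τ)}` with
`p(τ) p(τ̄) = 1` on paired blocks — there is `u ∈ G_div(X)(ℂ) = divisorLefschetzGroup A h` with underlying map
`p(ζ^*)`: the torus / sign elements `U_{ℚ(ζ)}(ℂ) ⊆ G_div(X)(ℂ)` («for X of type 4 with d ≥ 2 or m ≥ 2 this is a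
connected torus of rank e₀; in all other cases it is finite»). They are CENTRAL in `G_div(X)(ℂ)` as soon as
`ζ^* ∈ B ⊗ ℂ` (`exists_mem_center_divisorLefschetzGroup_coe_eq_aeval`).
[cite: MoonenZarhin1998WeilClasses, §1 Lemma (1) (chunk p0002 L121–L127)] [cite: Milne1999LefschetzClasses, §2 pp. 645–650] -/
theorem exists_mem_divisorLefschetzGroup_coe_eq_aeval_of_adjoint (hPirr : Irreducible (P.map (Int.castRingHom ℚ)))
    (hζ : Polynomial.eval₂ (Int.castRingHom (CategoryTheory.End A)) (ζ : CategoryTheory.End A) P = 0)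
    (hζC : pullbackOne A ζ ∈ centralizerAlgebra A) {q : ℂ[X]}
    (hadj : ∀ x y : complexBetti A.X 1, polarizationPairingOne A.X h (A.dim - 1) (pullbackOne A ζ x) y =
      polarizationPairingOne A.X h (A.dim - 1) x (aeval (pullbackOne A ζ) q y))
    (p : ℂ[X]) (hp : ∀ τ : ℂ, Module.End.HasEigenvalue (pullbackOne A ζ) τ → p.eval τ * p.eval (q.eval τ) = 1) :
    ∃ u ∈ divisorLefschetzGroup A h,
      (u : complexBetti A.X 1 →ₗ[ℂ] complexBetti A.X 1) = aeval (pullbackOne A ζ) p := by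
  have h1 := aeval_pullbackOne_mul_aeval_comp_eq_one hPirr hζ p q hp
  have h2 := aeval_comp_mul_aeval_pullbackOne_eq_one hPirr hζ p q hp
  have hc1 : aeval (pullbackOne A ζ) p ∘ₗ aeval (pullbackOne A ζ) (p.comp q) = LinearMap.id :=
    LinearMap.ext fun x ↦ by simpa using LinearMap.congr_fun h1 x
  have hc2 : aeval (pullbackOne A ζ) (p.comp q) ∘ₗ aeval (pullbackOne A ζ) p = LinearMap.id :=
    LinearMap.ext fun x ↦ by simpa using LinearMap.congr_fun h2 x
  refine ⟨LinearEquiv.ofLinear _ _ hc1 hc2, ⟨fun T hT x ↦ ?_, fun x y ↦ ?_⟩, rfl⟩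
  · -- `p(ζ^*)` commutes with `S_λ ⊗ ℂ ⊆ span of pull-backs` (centrality of `ζ`)
    exact aeval_pullbackOne_apply_eq_of_mem_span_pullbackOne hPirr hζ hζC hT.1 p x
  · -- `Q_h`-invariance, blockwise on the paired blocks `V^{(q τ′)} × V^{(τ′)}`: `p(q τ′) p(τ′) = 1`
    change polarizationPairingOne A.X h (A.dim - 1) (aeval (pullbackOne A ζ) p x) (aeval (pullbackOne A ζ) p y) = _
    refine polarizationPairingOne_map_eq_of_forall_eigenspace_of_adjoint hPirr hζ hadj
      (fun τ x hx ↦ aeval_pullbackOne_apply_mem_eigenspace p hx) (fun τ τ' e x hx y hy ↦ ?_) x y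
    by_cases hy0 : y = 0
    · simp [hy0]
    · have key : p.eval τ * p.eval τ' = 1 := by
        rw [e, mul_comm]; exact hp τ' (Module.End.hasEigenvalue_of_hasEigenvector ⟨hy, hy0⟩)
      rw [aeval_apply_of_mem_eigenspace hx, aeval_apply_of_mem_eigenspace hy]
      simp only [map_smul, LinearMap.smul_apply, smul_smul]
      first
      | rw [key, one_smul]
      | (rw [mul_comm] at key; rw [key, one_smul])

/-- `Q_h(y, x) = -Q_h(x, y)` on `H¹` (graded commutativity of the cup product; the tree's `polarizationPairingOne_swap`
in `WeilTypePeriodPoint`, restated to keep the import closure small). [cite: LangeBirkenhake1992, §5.1] -/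
private theorem polarizationPairingOne_swap' (x y : complexBetti A.X 1) :
    polarizationPairingOne A.X h (A.dim - 1) y x = -polarizationPairingOne A.X h (A.dim - 1) x y := by
  rw [polarizationPairingOne_apply, polarizationPairingOne_apply,
    cupProduct_gradedComm_holds (R := ℂ) (X := ComplexPoints A.X) rfl rfl y x, map_smul, pow_one, neg_one_smul]

/-- **`a a† = 1` is NECESSARY**: if `p(ζ^*)` preserves a NON-DEGENERATE `Q_h` (`ζ` with `P(ζ) = 0`, `P` irreducible,
`Q_h(ζ^* x, y) = Q_h(x, q(ζ^*) y)`), then `p(τ) · p(q(τ)) = 1` at every eigenvalue `τ` of `ζ^*`: on the paired blocks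
`V^{(q τ)} × V^{(τ)}` the form is scaled by `p(q τ) p(τ)`, and some such pair carries a non-zero value of `Q_h`.
[cite: MoonenZarhin1998WeilClasses, §1 Lemma (1) (chunk p0002 L121–L124: «a a† = 1»)] -/
theorem eval_mul_eval_eq_one_of_forall_polarizationPairingOne_aeval_eq (hPirr : Irreducible (P.map (Int.castRingHom ℚ)))
    (hζ : Polynomial.eval₂ (Int.castRingHom (CategoryTheory.End A)) (ζ : CategoryTheory.End A) P = 0) {q : ℂ[X]}
    (hadj : ∀ x y : complexBetti A.X 1, polarizationPairingOne A.X h (A.dim - 1) (pullbackOne A ζ x) y =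
      polarizationPairingOne A.X h (A.dim - 1) x (aeval (pullbackOne A ζ) q y))
    (hnd : ∀ x : complexBetti A.X 1, (∀ y, polarizationPairingOne A.X h (A.dim - 1) x y = 0) → x = 0) {p : ℂ[X]}
    (hQ : ∀ x y : complexBetti A.X 1,
      polarizationPairingOne A.X h (A.dim - 1) (aeval (pullbackOne A ζ) p x) (aeval (pullbackOne A ζ) p y) =
        polarizationPairingOne A.X h (A.dim - 1) x y)
    {τ : ℂ} (hτ : Module.End.HasEigenvalue (pullbackOne A ζ) τ) : p.eval τ * p.eval (q.eval τ) = 1 := by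
  obtain ⟨y, hy⟩ := hτ.exists_hasEigenvector
  set c : ℂ := p.eval τ * p.eval (q.eval τ) with hc
  -- on every block, hence everywhere: `Q_h(p(ζ^*) x, p(ζ^*) y) = c • Q_h(x, y)`
  have key : ∀ x, polarizationPairingOne A.X h (A.dim - 1) (aeval (pullbackOne A ζ) p x) (aeval (pullbackOne A ζ) p y) =
      c • polarizationPairingOne A.X h (A.dim - 1) x y := by
    intro x
    refine Submodule.iSup_induction
      (motive := fun x ↦ polarizationPairingOne A.X h (A.dim - 1) (aeval (pullbackOne A ζ) p x)
        (aeval (pullbackOne A ζ) p y) = c • polarizationPairingOne A.X h (A.dim - 1) x y) _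
      (mem_iSup_eigenspace_pullbackOne hPirr hζ x) (fun σ x hx ↦ ?_) (by simp) fun x x' hx hx' ↦ ?_
    · by_cases hσ : σ = q.eval τ
      · rw [aeval_apply_of_mem_eigenspace hx, aeval_apply_of_mem_eigenspace hy.1]
        subst hσ
        simp only [map_smul, LinearMap.smul_apply, smul_smul, hc]
      · rw [polarizationPairingOne_eq_zero_of_mem_eigenspace_of_ne_eval hadj hσ hx hy.1,
          polarizationPairingOne_eq_zero_of_mem_eigenspace_of_ne_eval hadj hσ
            (aeval_pullbackOne_apply_mem_eigenspace p hx) (aeval_pullbackOne_apply_mem_eigenspace p hy.1), smul_zero]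
    · simp only [map_add, LinearMap.add_apply, hx, hx', smul_add]
  -- some `x` pairs non-trivially with `y ≠ 0` (non-degeneracy, moved to the right slot by antisymmetry)
  obtain ⟨x, hx⟩ : ∃ x, polarizationPairingOne A.X h (A.dim - 1) x y ≠ 0 := by
    by_contra! H
    exact hy.2 (hnd y fun x ↦ by rw [polarizationPairingOne_swap', H x, neg_zero])
  have e := key x
  rw [hQ] at e
  have e' : (c - 1) • polarizationPairingOne A.X h (A.dim - 1) x y = 0 := by rw [sub_smul, one_smul, ← e, sub_self]
  exact sub_eq_zero.1 ((smul_eq_zero.1 e').resolve_right hx)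

/-- **LEMMA (1)'s description of the elements, as an `iff`**: for a central `ζ` with `ζ† = q(ζ)` (`P(ζ) = 0`, `P`
irreducible) and `Q_h` NON-DEGENERATE, `p(ζ^*)` underlies an element of `G_div(X)(ℂ)` IF AND ONLY IF `a a† = 1`,
i.e. `p(τ) · p(q(τ)) = 1` at every eigenvalue `τ` — «`U_{K_B}(R) = {a ∈ (K_B ⊗_ℚ R)^* | a a† = 1}`» for the
elements `a ∈ ℚ(ζ) ⊗ ℂ = ℂ[ζ^*]`. [cite: MoonenZarhin1998WeilClasses, §1 Lemma (1) (chunk p0002 L121–L127)] -/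
theorem exists_mem_divisorLefschetzGroup_coe_eq_aeval_iff (hPirr : Irreducible (P.map (Int.castRingHom ℚ)))
    (hζ : Polynomial.eval₂ (Int.castRingHom (CategoryTheory.End A)) (ζ : CategoryTheory.End A) P = 0)
    (hζC : pullbackOne A ζ ∈ centralizerAlgebra A) {q : ℂ[X]}
    (hadj : ∀ x y : complexBetti A.X 1, polarizationPairingOne A.X h (A.dim - 1) (pullbackOne A ζ x) y =
      polarizationPairingOne A.X h (A.dim - 1) x (aeval (pullbackOne A ζ) q y))
    (hnd : ∀ x : complexBetti A.X 1, (∀ y, polarizationPairingOne A.X h (A.dim - 1) x y = 0) → x = 0) (p : ℂ[X]) :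
    (∃ u ∈ divisorLefschetzGroup A h,
        (u : complexBetti A.X 1 →ₗ[ℂ] complexBetti A.X 1) = aeval (pullbackOne A ζ) p) ↔
      ∀ τ : ℂ, Module.End.HasEigenvalue (pullbackOne A ζ) τ → p.eval τ * p.eval (q.eval τ) = 1 := by
  refine ⟨fun ⟨u, hu, hup⟩ τ hτ ↦ ?_, exists_mem_divisorLefschetzGroup_coe_eq_aeval_of_adjoint hPirr hζ hζC hadj p⟩
  have hux : ∀ x, u x = aeval (pullbackOne A ζ) p x := fun x ↦ LinearMap.congr_fun hup x
  exact eval_mul_eval_eq_one_of_forall_polarizationPairingOne_aeval_eq hPirr hζ hadj hnd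
    (fun x y ↦ by rw [← hux, ← hux]; exact hu.2 x y) hτ

/-- **The sign elements `μ₂^{Σ_{E₀}} = U_{E₀}(ℂ) ⊆ G_div(X)(ℂ)`.**  For a CENTRAL `†`-SYMMETRIC `ζ ∈ End(A)`
(`P(ζ) = 0`, `P` irreducible) and every `p ∈ ℂ[T]` with `p(τ)² = 1` at each eigenvalue `τ` of `ζ^*`, the involution
`p(ζ^*)` — acting as the sign `p(τ) = ±1` on the block `V^{(τ)}`, the signs being chosen INDEPENDENTLY — underlies
an element of `G_div(X)(ℂ)`: `2^{#Σ}` independent blockwise elements witnessing the product structure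
`∏_τ G_div^{(τ)}`; for types I–III (`K_B = E₀` totally real) these are exactly `U_{K_B}(ℂ) = (Res_{E₀/ℚ} μ₂)(ℂ)`
(«in all other cases it is finite»). [cite: MoonenZarhin1998WeilClasses, §1 Lemma (1) + chunk p0002 L86–L100] -/
theorem exists_mem_divisorLefschetzGroup_coe_eq_aeval (hPirr : Irreducible (P.map (Int.castRingHom ℚ)))
    (hζ : Polynomial.eval₂ (Int.castRingHom (CategoryTheory.End A)) (ζ : CategoryTheory.End A) P = 0)
    (hζC : pullbackOne A ζ ∈ centralizerAlgebra A)
    (hsym : ∀ x y : complexBetti A.X 1, polarizationPairingOne A.X h (A.dim - 1) (pullbackOne A ζ x) y =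
      polarizationPairingOne A.X h (A.dim - 1) x (pullbackOne A ζ y))
    (p : ℂ[X]) (hp : ∀ τ : ℂ, Module.End.HasEigenvalue (pullbackOne A ζ) τ → p.eval τ ^ 2 = 1) :
    ∃ u ∈ divisorLefschetzGroup A h,
      (u : complexBetti A.X 1 →ₗ[ℂ] complexBetti A.X 1) = aeval (pullbackOne A ζ) p :=
  exists_mem_divisorLefschetzGroup_coe_eq_aeval_of_adjoint hPirr hζ hζC (q := X) (fun x y ↦ by simpa using hsym x y) p
    fun τ hτ ↦ by rw [eval_X, ← sq]; exact hp τ hτ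

/-- **… and they are CENTRAL in `G_div(X)(ℂ)` when `ζ^* ∈ B ⊗ ℂ`** (the subalgebra generated by `S_λ ⊗ ℂ`; e.g.
`ζ ∈ K_B = Z(B)`, in particular `ζ ∈ E₀`-symmetric): «the center of `G_div(X)` is the group `U_{K_B}`», inclusion
`U_{K_B}(ℂ) ⊆ Z(G_div(X))(ℂ)` WITH its elements exhibited (the tree's `mem_center_divisorLefschetzGroup_of_coe_mem_adjoin`
gives centrality of any element of `G_div(X)(ℂ) ∩ (B ⊗ ℂ)`; this theorem produces them).
[cite: MoonenZarhin1998WeilClasses, §1 Lemma (1) (chunk p0002 L121–L127)] -/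
theorem exists_mem_center_divisorLefschetzGroup_coe_eq_aeval (hPirr : Irreducible (P.map (Int.castRingHom ℚ)))
    (hζ : Polynomial.eval₂ (Int.castRingHom (CategoryTheory.End A)) (ζ : CategoryTheory.End A) P = 0)
    (hζC : pullbackOne A ζ ∈ centralizerAlgebra A)
    (hζB : pullbackOne A ζ ∈ Algebra.adjoin ℂ (symmetricPullbackSpan A h : Set (Module.End ℂ (complexBetti A.X 1))))
    {q : ℂ[X]}
    (hadj : ∀ x y : complexBetti A.X 1, polarizationPairingOne A.X h (A.dim - 1) (pullbackOne A ζ x) y =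
      polarizationPairingOne A.X h (A.dim - 1) x (aeval (pullbackOne A ζ) q y))
    (p : ℂ[X]) (hp : ∀ τ : ℂ, Module.End.HasEigenvalue (pullbackOne A ζ) τ → p.eval τ * p.eval (q.eval τ) = 1) :
    ∃ z ∈ Subgroup.center (divisorLefschetzGroup A h),
      ((z : complexBetti A.X 1 ≃ₗ[ℂ] complexBetti A.X 1) : complexBetti A.X 1 →ₗ[ℂ] complexBetti A.X 1) =
        aeval (pullbackOne A ζ) p := by
  obtain ⟨u, hu, hup⟩ := exists_mem_divisorLefschetzGroup_coe_eq_aeval_of_adjoint hPirr hζ hζC hadj p hp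
  refine ⟨⟨u, hu⟩, mem_center_divisorLefschetzGroup_of_coe_mem_adjoin ?_, hup⟩
  change (u : complexBetti A.X 1 →ₗ[ℂ] complexBetti A.X 1) ∈ _
  rw [hup]
  exact Algebra.adjoin_le (Set.singleton_subset_iff.2 hζB) (aeval_mem_adjoin_singleton ℂ _)

/-- **Every `u ∈ G_div(X)(ℂ)` commutes with `p(ζ^*)` for a `†`-symmetric `ζ`** (`u` commutes with `ζ^* ∈ S_λ ⊗ ℂ`,
hence preserves the blocks on which `p(ζ^*)` is scalar): the sign elements are central — `U_{E₀}(ℂ) ⊆ Z(G_div(X))(ℂ)`.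
[cite: MoonenZarhin1998WeilClasses, §1 Lemma (1)] -/
theorem apply_aeval_pullbackOne_eq_of_mem_divisorLefschetzGroup (hPirr : Irreducible (P.map (Int.castRingHom ℚ)))
    (hζ : Polynomial.eval₂ (Int.castRingHom (CategoryTheory.End A)) (ζ : CategoryTheory.End A) P = 0)
    (hsym : ∀ x y : complexBetti A.X 1, polarizationPairingOne A.X h (A.dim - 1) (pullbackOne A ζ x) y =
      polarizationPairingOne A.X h (A.dim - 1) x (pullbackOne A ζ y))
    (hu : u ∈ divisorLefschetzGroup A h) (p : ℂ[X]) (x : complexBetti A.X 1) :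
    u (aeval (pullbackOne A ζ) p x) = aeval (pullbackOne A ζ) p (u x) :=
  apply_apply_eq_of_forall_eigenspace hPirr hζ (fun τ x hx ↦ by
    rw [aeval_apply_of_mem_eigenspace hx, map_smul,
      aeval_apply_of_mem_eigenspace (apply_mem_eigenspace_of_mem_divisorLefschetzGroup hsym hu hx)]) x

/-- **The same elements lie in Milne's `S(A)(h)(ℂ)` and are central there** (they are `ℂ`-polynomials in the
central pull-back `ζ^*`, with `a a† = 1`): `U_{ℚ(ζ)}(ℂ) ⊆ Z(S(A)(h))(ℂ)` — Milne §2's tori `∏_σ` in the centre of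
`S(A)`. [cite: Milne1999LefschetzClasses, §2 pp. 645–650] [cite: MoonenZarhin1998WeilClasses, §1 Lemma (1)] -/
theorem exists_mem_unitaryCentralizerGroup_coe_eq_aeval_of_adjoint (hPirr : Irreducible (P.map (Int.castRingHom ℚ)))
    (hζ : Polynomial.eval₂ (Int.castRingHom (CategoryTheory.End A)) (ζ : CategoryTheory.End A) P = 0)
    (hζC : pullbackOne A ζ ∈ centralizerAlgebra A) {q : ℂ[X]}
    (hadj : ∀ x y : complexBetti A.X 1, polarizationPairingOne A.X h (A.dim - 1) (pullbackOne A ζ x) y =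
      polarizationPairingOne A.X h (A.dim - 1) x (aeval (pullbackOne A ζ) q y))
    (p : ℂ[X]) (hp : ∀ τ : ℂ, Module.End.HasEigenvalue (pullbackOne A ζ) τ → p.eval τ * p.eval (q.eval τ) = 1) :
    ∃ u ∈ unitaryCentralizerGroup A h,
      (u : complexBetti A.X 1 →ₗ[ℂ] complexBetti A.X 1) = aeval (pullbackOne A ζ) p ∧
      ∀ v ∈ unitaryCentralizerGroup A h, ∀ x, v (u x) = u (v x) := by
  obtain ⟨u, hu, hup⟩ := exists_mem_divisorLefschetzGroup_coe_eq_aeval_of_adjoint hPirr hζ hζC hadj p hp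
  have hux : ∀ x, u x = aeval (pullbackOne A ζ) p x := fun x ↦ LinearMap.congr_fun hup x
  refine ⟨u, ⟨mem_centralizerGroup_iff.2 fun φ x ↦ ?_, hu.2⟩, hup, fun v hv x ↦ ?_⟩
  · rw [hux, hux]
    exact aeval_pullbackOne_apply_eq_of_mem_span_pullbackOne hPirr hζ hζC (Submodule.subset_span ⟨φ, rfl⟩) p x
  · rw [hux, hux]
    exact apply_apply_eq_of_forall_eigenspace hPirr hζ (fun τ x hx ↦ by
      rw [aeval_apply_of_mem_eigenspace hx, map_smul,
        aeval_apply_of_mem_eigenspace (apply_mem_eigenspace_of_mem_unitaryCentralizerGroup hv hx)]) x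

/-! ### §6 (rider) «in all other cases it is finite»: for `†`-symmetric `ζ` the elements `p(ζ^*) ∈ G_div(X)(ℂ)`
are involutions determined by a sign vector `Σ → {±1}` -/

/-- **«… in all other cases it is finite» — the `E₀`-part of `U_{K_B}(ℂ)` is `2`-torsion.**  For a `†`-SYMMETRIC `ζ`
(`P(ζ) = 0`, `P` irreducible) and `Q_h` non-degenerate, if `p(ζ^*)` underlies an element `u ∈ G_div(X)(ℂ)` then
`p(τ)² = 1`, i.e. `p(τ) = ±1`, at every eigenvalue `τ` of `ζ^*` (Lemma (1)'s `a a† = 1` with `a† = a`).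
[cite: MoonenZarhin1998WeilClasses, §1 Lemma (1) (chunk p0002 L121–L127: «in all other cases it is finite»)] -/
theorem eval_eq_one_or_eval_eq_neg_one_of_mem_divisorLefschetzGroup_coe_eq_aeval
    (hPirr : Irreducible (P.map (Int.castRingHom ℚ)))
    (hζ : Polynomial.eval₂ (Int.castRingHom (CategoryTheory.End A)) (ζ : CategoryTheory.End A) P = 0)
    (hsym : ∀ x y : complexBetti A.X 1, polarizationPairingOne A.X h (A.dim - 1) (pullbackOne A ζ x) y =
      polarizationPairingOne A.X h (A.dim - 1) x (pullbackOne A ζ y))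
    (hnd : ∀ x : complexBetti A.X 1, (∀ y, polarizationPairingOne A.X h (A.dim - 1) x y = 0) → x = 0) {p : ℂ[X]}
    (hu : u ∈ divisorLefschetzGroup A h)
    (hup : (u : complexBetti A.X 1 →ₗ[ℂ] complexBetti A.X 1) = aeval (pullbackOne A ζ) p)
    {τ : ℂ} (hτ : Module.End.HasEigenvalue (pullbackOne A ζ) τ) : p.eval τ = 1 ∨ p.eval τ = -1 := by
  have hux : ∀ x, u x = aeval (pullbackOne A ζ) p x := fun x ↦ LinearMap.congr_fun hup x
  have h1 := eval_mul_eval_eq_one_of_forall_polarizationPairingOne_aeval_eq hPirr hζ (q := X)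
    (fun x y ↦ by simpa using hsym x y) hnd (p := p) (fun x y ↦ by rw [← hux, ← hux]; exact hu.2 x y) hτ
  rw [eval_X] at h1
  exact mul_self_eq_one_iff.1 h1

/-- **… hence `u² = 1`**: every element of `G_div(X)(ℂ)` of the form `p(ζ^*)`, `ζ` `†`-symmetric, is an involution
(`Q_h` non-degenerate). [cite: MoonenZarhin1998WeilClasses, §1 Lemma (1) (chunk p0002 L121–L127)] -/
theorem mul_self_eq_one_of_mem_divisorLefschetzGroup_coe_eq_aeval (hPirr : Irreducible (P.map (Int.castRingHom ℚ)))
    (hζ : Polynomial.eval₂ (Int.castRingHom (CategoryTheory.End A)) (ζ : CategoryTheory.End A) P = 0)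
    (hsym : ∀ x y : complexBetti A.X 1, polarizationPairingOne A.X h (A.dim - 1) (pullbackOne A ζ x) y =
      polarizationPairingOne A.X h (A.dim - 1) x (pullbackOne A ζ y))
    (hnd : ∀ x : complexBetti A.X 1, (∀ y, polarizationPairingOne A.X h (A.dim - 1) x y = 0) → x = 0) {p : ℂ[X]}
    (hu : u ∈ divisorLefschetzGroup A h)
    (hup : (u : complexBetti A.X 1 →ₗ[ℂ] complexBetti A.X 1) = aeval (pullbackOne A ζ) p) : u * u = 1 := by
  have hsq := aeval_pullbackOne_mul_self_eq_one hPirr hζ p fun τ hτ ↦ by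
    rcases eval_eq_one_or_eval_eq_neg_one_of_mem_divisorLefschetzGroup_coe_eq_aeval hPirr hζ hsym hnd hu hup hτ with
      h1 | h1 <;> rw [h1] <;> norm_num
  refine LinearEquiv.ext fun x ↦ ?_
  have hux : ∀ x, u x = aeval (pullbackOne A ζ) p x := fun x ↦ LinearMap.congr_fun hup x
  rw [LinearEquiv.mul_apply, hux, hux, ← Module.End.mul_apply, hsq, Module.End.one_apply]
  rfl

/-- **… and `u` is determined by its sign vector** `τ ↦ p(τ) ∈ {±1}` on the eigenvalues: two such elements with the
same signs at every eigenvalue are equal — at most `2^{#Σ}` of them («finite»).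
[cite: MoonenZarhin1998WeilClasses, §1 Lemma (1) (chunk p0002 L121–L127)] -/
theorem eq_of_coe_eq_aeval_of_forall_eval_eq (hPirr : Irreducible (P.map (Int.castRingHom ℚ)))
    (hζ : Polynomial.eval₂ (Int.castRingHom (CategoryTheory.End A)) (ζ : CategoryTheory.End A) P = 0)
    {u u' : complexBetti A.X 1 ≃ₗ[ℂ] complexBetti A.X 1} {p p' : ℂ[X]}
    (hup : (u : complexBetti A.X 1 →ₗ[ℂ] complexBetti A.X 1) = aeval (pullbackOne A ζ) p)
    (hup' : (u' : complexBetti A.X 1 →ₗ[ℂ] complexBetti A.X 1) = aeval (pullbackOne A ζ) p')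
    (hpp' : ∀ τ : ℂ, Module.End.HasEigenvalue (pullbackOne A ζ) τ → p.eval τ = p'.eval τ) : u = u' := by
  refine LinearEquiv.toLinearMap_injective ?_
  rw [hup, hup']
  refine eq_of_forall_eigenspace_apply_eq hPirr hζ fun τ x hx ↦ ?_
  by_cases hx0 : x = 0
  · simp [hx0]
  · rw [aeval_apply_of_mem_eigenspace hx, aeval_apply_of_mem_eigenspace hx,
      hpp' τ (Module.End.hasEigenvalue_of_hasEigenvector ⟨hx, hx0⟩)]

end HodgeTheory

end Literature.AlgebraicGeometry.HodgeTheory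

end
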